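import Summits.BirchSwinnertonDyer.BirchSwinnertonDyer.Theorems.SchneiderFreeAdditiveX3IsogenyCharacterDirichlet
import Summits.BirchSwinnertonDyer.BirchSwinnertonDyer.Theorems.SchneiderFreeAdditiveX3KrizLiLocusLValueFree
import Literature.NumberTheory.EllipticCurves.InertiaFixedTorsionAdditiveIndexBoundProofs
import Literature.NumberTheory.EllipticCurves.TorsionLevelLoweringGoodReductionProofs
import Literature.NumberTheory.GaloisRepresentations.DecompositionGroupOfCompletion
import HarnessLib

/-!
# Kriz–Li 2019 Thm. 1.20, hypothesis (3) («`ψ(ℓ) ≠ 1` and `(ψ⁻¹ω)(ℓ) ≠ 1` at every additive prime `ℓ ≠ p`») is AUTOMATIC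
# at every prime `p ≥ 5`: the isogeny character of a rational `p`-line is RAMIFIED at the additive primes `ℓ ≠ p`
# (route `SchneiderFreeAdditiveX3`, K1 door, Kriz–Li corner; general lemmas)

Cell `bsd-schneider-ideate`, seat `bsd-schneider-door-c5` (prover, generation 37; `--supports` 19177 as helper).  PARTITION: board row
B6 ∩ X3 ∩ sst-twist, `r = 1`, at the primes `p ≥ 5` (284 census pairs at `p = 5`, 23 at `p ∈ {7, 13}`, the `p = 37` row; class-wide) —
the KRIZ–LI SUB-LOCUS of the door (generation 36: `KrizLiLocusLValueFree`, `KrizLiLocusSupplyThree`, `IsogenyCharacterDirichlet`);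
types-the-object-of nothing new; closes none of B6's cells; BSD NOT advanced; «closes rung: none».  bears_on: K1-door (19177).

WHY.  On the Kriz–Li road of the door (`KrizLiLocusLValueFree.missingLowerBoundAt_of_printedFacts_of_thm120_of_heegnerField`) the lower
half of BSD_p at a pair `(W, p)` follows from `PrintedFacts` + Kriz–Li Thm. 1.20 + character data `(f, ψ, ω)` subject to Kriz–Li's
hypotheses (1) at `p`, (2) «no split multiplicative prime», (3) «`ψ(ℓ) ≠ 1` and `(ψ⁻¹ω)(ℓ) ≠ 1` at every additive `ℓ ≠ p`» and the
Bernoulli pair (4).  Generation 36 showed the data EXIST for every curve with `E[p]` reducible (`exists_krizLiCharacterData_of_red`: `ψ` is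
the Teichmüller lift of the isogeny character `r` of a rational `p`-line `⟨T⟩ ≤ E[p]`, written `r = φ ∘ χ_f` with `φ` primitive).  This
file shows that for THAT datum hypothesis (3) is a THEOREM whenever `p ≥ 5`:

* §1 `eq_zero_of_absInertia_fixed_of_hasAdditiveReductionAt_of_five_le` (general `E/K`, `K` a number field): at a place `v ∤ p` of
  ADDITIVE reduction, `p ≥ 5` prime, a `p`-torsion point of `E(K̄)` fixed by the local inertia group is `O` — the tree's bound
  `natCard_le_four_of_absInertia_fixed_of_hasAdditiveReductionAt` («an inertia-fixed subgroup of `E[p]` has `≤ 4` points», Silverman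
  *AEC* VII.6.1: `E(K_v^nr)[p] ↪ E(K_v^nr)/E₀(K_v^nr)`, order `≤ 4`) applied to `ℤ·Q`, of order `p ≥ 5` if `Q ≠ O`;
* §2 `exists_mem_inertia_isogenyCharacter_ne_one` (`E/ℚ`): hence the isogeny character `r` of a rational `p`-line (`σT = r(σ)T`, Mazur
  1978 §5) is RAMIFIED at every prime `ℓ ≠ p` of additive reduction: some `τ` in the inertia group of the prime `𝔓₀ = adicCompletionPrime ℚ v`
  above `ℓ` (`= res I_{ℚ_ℓ}`, `inertia_adicCompletionPrime_eq_map_absInertia`) has `r(τ) ≠ 1`;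
* §3 Dirichlet side: `r = φ ∘ χ_f` ramified at `ℓ` forces `ℓ ∣ f` (`χ_f` is unramified off `f`, `modNCyclotomicCharacter_eq_one_of_mem_inertia`);
  then `ψ(ℓ) = 0` (`ℓ` is not a unit mod `f`) and the PRIMITIVE character inducing `ψ⁻¹ω` has conductor divisible by `ℓ`
  (`f = f(ψ⁻¹) ∣ lcm(f(ψ⁻¹ω), f(ω⁻¹))`, Mathlib `conductor_mul_dvd_lcm_conductor`, and `f(ω) ∣ p ≠ ℓ`), so `(ψ⁻¹ω)(ℓ) = 0`
  (tree `primVal`);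
* §4 **`exists_krizLiCharacterData_h3_of_red`**: for `W/ℚ` globally minimal, `p ≥ 5`, `E[p]` reducible: character data `(f, ψ, ω)` with
  generation 36's four properties AND «every additive `ℓ ≠ p` divides `f`» AND hypothesis (3) in the exact shape of
  `KrizLi2019.thm120_padicLogHeegner_unit_of_bernoulli`;
* §5 on the door: `exists_krizLiCharacterData_h3_of_classX3`, and **`missingLowerBoundAt_of_printedFacts_of_thm120_of_forall_data_of_five_le`**
  — the lower half of BSD_p at a door pair with `p ≥ 5` from `PrintedFacts` + Thm. 1.20 + (2) + «for every admissible character datum: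
  (1) and a Heegner field (odd `d_K`) with the Bernoulli pair (4)» — hypothesis (3) is no longer an input.

At `p = 3` the bound `#E[3]^{I_ℓ} ≤ 4` allows a fixed LINE (Kodaira `IV`/`IV*`, tree `InertiaFixedTorsionTypeIVProofs`), and (3) is a
genuine condition (generation 36's census: (1)–(3) hold at 24 of the 6 794 door pairs at `p = 3`).  Hypothesis (1) (at `ℓ = p`) is NOT
treated: `E(ℚ_p^nr)[p]` is not bounded by the component group at the prime `p` itself.

HONEST FRAMING: §1–§4 and `exists_krizLiCharacterData_h3_of_classX3` are UNCONDITIONAL tree theorems (no definition, no named fact, no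
`sorry`); `missingLowerBoundAt_…_of_five_le` is CONDITIONAL on its displayed named facts (`PrintedFacts` = thirteen published theorems, item
19184; Kriz–Li 2019 Thm. 1.20, PUBLISHED) and on its per-pair hypotheses (1), (2), (4); nothing is closed; the branch cruxes r2/r3 of the
door are untouched; BSD is proved for no curve; «closes rung: none».
References: [KrizLi2019] D. Kriz, C. Li, Forum Math. Sigma 7 (2019) e15, Thm. 1.20 = Thm. 7.1 (pp. 7–8, 42–43), §2 (p. 11);
[SilvermanAEC2009] Thm. VII.6.1, Cor. VII.6.2, proof of Thm. VII.7.1 (PDF pp. 177–179); [SilvermanATAEC1994] Cor. IV.9.2 (d), Thm. IV.10.2 (a);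
[Mazur1978] §5 (p. 148); [NeukirchANT1999] Ch. II §9 (9.6); [Washington1997] Prop. 2.3, Ch. 3, §5.1; this seat p743469 (`IsogenyCharacterDirichlet`),
p741544 (`KrizLiLocusLValueFree`).
-/

set_option autoImplicit false
-- `Summit.<P>.<Sub>` repeats `BirchSwinnertonDyer` by the tree's layout convention (D-0017)
set_option linter.dupNamespace false

noncomputable section

open scoped Classical NumberField

open NumberField IsDedekindDomain IsDedekindDomain.HeightOneSpectrum Field WeierstrassCurve
  Literature.NumberTheory.GaloisRepresentations Literature.NumberTheory.EllipticCurves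
  Literature.NumberTheory.EllipticCurves.KrizLi2019

namespace Summit.BirchSwinnertonDyer.BirchSwinnertonDyer.Theorems.SchneiderFreeAdditiveX3.KrizLiThreeAutomatic

universe u

/-! ### §1 Additive reduction at `v ∤ p`, `p ≥ 5`: no non-zero inertia-fixed `p`-torsion point -/

/-- **Additive reduction at `v ∤ p`, `p ≥ 5`: an inertia-fixed `p`-torsion point is `O`.**  For `E/K` elliptic over a number field, a
finite place `v` of ADDITIVE reduction, a prime `p ≥ 5` with `v ∤ p`, and `Q ∈ E[p] ≤ E(K̄)` fixed by the local inertia group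
`absInertia K_v` (acting through `absGaloisRestrict K K_v`): `Q = O`.  Proof: the subgroup `ℤ·Q ≤ E[p]` is inertia-fixed, so it has at most
`4` points (tree `natCard_le_four_of_absInertia_fixed_of_hasAdditiveReductionAt`: `E(K_v^nr)[p]` injects into `E(K_v^nr)/E₀(K_v^nr)`, of
order `≤ 4` at an additive place, `E₀` having no `p`-torsion at a cusp); if `Q ≠ O` it has exactly `p ≥ 5` points.
[cite: SilvermanAEC2009, Thm. VII.6.1 with Cor. VII.6.2 (PDF p. 177) and proof of Thm. VII.7.1 (PDF p. 179)]
[cite: SilvermanATAEC1994, Thm. IV.10.2(a), additive case (PDF pp. 358–359)] -/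
theorem eq_zero_of_absInertia_fixed_of_hasAdditiveReductionAt_of_five_le
    {K : Type u} [Field K] [NumberField K] {v : HeightOneSpectrum (𝓞 K)}
    (W : WeierstrassCurve K) [W.IsElliptic] (hadd : W.HasAdditiveReductionAt v)
    {p : ℕ} (hp : p.Prime) (h5 : 5 ≤ p) (hpv : (p : 𝓞 K) ∉ v.asIdeal)
    {Q : geomPoints W} (hQ : Q ∈ geomTorsion W (p : ℤ))
    (hfix : ∀ σ ∈ absInertia (v.adicCompletion K), absGaloisRestrict K (v.adicCompletion K) σ • Q = Q) :
    Q = 0 := by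
  haveI := Fact.mk hp
  by_contra hQ0
  set A : AddSubgroup (geomPoints W) := AddSubgroup.zmultiples Q with hA
  have hAp : A ≤ geomTorsion W (p : ℤ) := by
    rw [hA, AddSubgroup.zmultiples_le]  -- hmm
    exact hQ
  have hAI : ∀ σ ∈ absInertia (v.adicCompletion K), ∀ P ∈ A,
      absGaloisRestrict K (v.adicCompletion K) σ • P = P := by
    intro σ hσ P hP
    rw [hA] at hP
    obtain ⟨k, rfl⟩ := AddSubgroup.mem_zmultiples_iff.mp hP
    rw [show absGaloisRestrict K (v.adicCompletion K) σ • (k • Q) = k • (absGaloisRestrict K (v.adicCompletion K) σ • Q) from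
      map_zsmul (DistribSMul.toAddMonoidHom (geomPoints W) (absGaloisRestrict K (v.adicCompletion K) σ)) k Q, hfix σ hσ]
  have hle := W.natCard_le_four_of_absInertia_fixed_of_hasAdditiveReductionAt hadd hpv A hAp hAI
  have hpQ : p • Q = 0 := by
    have h := (mem_geomTorsion_iff W (p : ℤ) Q).mp hQ
    rwa [natCast_zsmul] at h
  have hord : addOrderOf Q = p := addOrderOf_eq_prime hpQ hQ0
  have hcard : Nat.card A = p := by rw [hA, Nat.card_zmultiples, hord]
  omega

/-! ### §2 Over `ℚ`: the isogeny character of a rational `p`-line is RAMIFIED at every additive prime `ℓ ≠ p` (`p ≥ 5`) -/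

/-- **The isogeny character of a rational `p`-line is RAMIFIED at every additive prime `ℓ ≠ p` (`p ≥ 5`).**  For `E/ℚ` elliptic, a prime
`p ≥ 5`, a point `P ∈ E[p] ∖ {O}` spanning a `Γ_ℚ`-stable line with isogeny character `r : Γ_ℚ → 𝔽_pˣ` (`σP = r(σ)P`, Mazur 1978 §5), and a
prime `ℓ ≠ p` at which `E` has neither good nor multiplicative reduction: at the place `v` of `ℚ` with `ℓ_v = ℓ` there are a prime `𝔓` of `\bar ℤ`
above `v` (namely `adicCompletionPrime ℚ v`, whose inertia group is `res(absInertia ℚ_ℓ)`) and `τ ∈ I_𝔓` with `r(τ) ≠ 1`.  Otherwise the local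
inertia group fixes `P`, contradicting §1. [cite: Mazur1978, §5 (p. 148, the isogeny character)]
[cite: SilvermanAEC2009, proof of Thm. VII.7.1 (PDF p. 179)] [cite: NeukirchANT1999, Ch. II §9 Prop. (9.6)] -/
theorem exists_mem_inertia_isogenyCharacter_ne_one (W : WeierstrassCurve ℚ) [W.IsElliptic]
    (p : ℕ) [hp : Fact p.Prime] (h5 : 5 ≤ p) {P : geomTorsion W p} (hP0 : P ≠ 0)
    {r : absoluteGaloisGroup ℚ →* (ZMod p)ˣ}
    (hr : ∀ σ : absoluteGaloisGroup ℚ, σ • P = ((r σ : (ZMod p)ˣ) : ZMod p).val • P)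
    {ℓ : ℕ} (hℓ : ℓ.Prime) (hℓp : ℓ ≠ p)
    (hng : ¬ (haveI := Fact.mk hℓ; W.HasGoodReductionAtPrime ℓ))
    (hnm : ¬ (haveI := Fact.mk hℓ; W.HasMultiplicativeReductionAtPrime ℓ)) :
    ∃ (v : HeightOneSpectrum (𝓞 ℚ)), Rat.HeightOneSpectrum.natGenerator v = ℓ ∧
      ∃ 𝔓 ∈ v.primesAbove, ∃ τ ∈ 𝔓.inertia (absoluteGaloisGroup ℚ), r τ ≠ 1 := by
  have hpP : p.Prime := hp.out
  -- the place `v` of `ℚ` with `ℓ_v = ℓ`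
  obtain ⟨v, hv⟩ : ∃ v : HeightOneSpectrum (𝓞 ℚ), Rat.HeightOneSpectrum.primesEquiv v = ⟨ℓ, hℓ⟩ :=
    ⟨(Rat.HeightOneSpectrum.primesEquiv (R := 𝓞 ℚ)).symm ⟨ℓ, hℓ⟩, Equiv.apply_symm_apply _ _⟩
  have hvℓ : ((Rat.HeightOneSpectrum.primesEquiv v : Nat.Primes) : ℕ) = ℓ := by rw [hv]
  have hadd : W.HasAdditiveReductionAt v := by
    refine W.hasAdditiveReductionAt_of_not_good_of_not_mult v ?_ ?_
    · rw [hv]; exact hng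
    · rw [hv]; exact hnm
  have hpv : ((p : ℕ) : 𝓞 ℚ) ∉ v.asIdeal := fun hmem =>
    hℓp (hvℓ.symm.trans (primesEquiv_eq_of_natCast_mem hpP hmem))
  refine ⟨v, hvℓ, adicCompletionPrime ℚ v, adicCompletionPrime_mem_primesAbove ℚ v, ?_⟩
  by_contra hall
  push Not at hall
  -- then the local inertia group fixes `P`, so `P = 0` by §1
  have hfix : ∀ σ ∈ absInertia (v.adicCompletion ℚ),
      absGaloisRestrict ℚ (v.adicCompletion ℚ) σ • (P : geomPoints W) = P := by
    intro σ hσ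
    have hτ : absGaloisRestrict ℚ (v.adicCompletion ℚ) σ ∈
        (adicCompletionPrime ℚ v).inertia (absoluteGaloisGroup ℚ) := by
      rw [inertia_adicCompletionPrime_eq_map_absInertia]
      exact Subgroup.mem_map_of_mem _ hσ
    have h1 : r (absGaloisRestrict ℚ (v.adicCompletion ℚ) σ) = 1 := hall _ hτ
    have h2 := hr (absGaloisRestrict ℚ (v.adicCompletion ℚ) σ)
    rw [h1, Units.val_one, ZMod.val_one, one_smul] at h2
    have h3 := congrArg (fun R : geomTorsion W p => (R : geomPoints W)) h2
    simpa only [AddSubgroup.torsionBy.coe_smul] using h3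
  have h0 := eq_zero_of_absInertia_fixed_of_hasAdditiveReductionAt_of_five_le W hadd hpP h5 hpv P.2 hfix
  exact hP0 (Subtype.ext h0)

/-! ### §3 Dirichlet side: a ramified prime divides the level; `ψ(ℓ) = 0` and `(ψ⁻¹ω)~(ℓ) = 0` there -/

/-- **A prime at which `φ ∘ χ_f` is ramified divides `f`.**  If `r : Γ_ℚ → 𝔽_pˣ` satisfies `r(σ) = φ(χ_f(σ))` for a Dirichlet character
`φ` mod `f` and some `τ` in the inertia group of a prime `𝔓` of `\bar ℤ` above `ℓ` has `r(τ) ≠ 1`, then `ℓ ∣ f`: the mod-`f` cyclotomic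
character is unramified at the primes not dividing `f` (`modNCyclotomicCharacter_eq_one_of_mem_inertia`).
[cite: Washington1997, Prop. 2.3 (p ∤ N is unramified in ℚ(ζ_N))] [cite: NeukirchANT1999, Ch. I (10.3)–(10.4)] -/
theorem dvd_level_of_inertia_ne_one {p : ℕ} [Fact p.Prime] {r : absoluteGaloisGroup ℚ →* (ZMod p)ˣ}
    {f : ℕ} [NeZero f] {φ : DirichletCharacter (ZMod p) f}
    (hφ : ∀ σ : absoluteGaloisGroup ℚ,
      φ ((modNCyclotomicCharacter ℚ f σ : (ZMod f)ˣ) : ZMod f) = ((r σ : (ZMod p)ˣ) : ZMod p))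
    {ℓ : ℕ} {v : HeightOneSpectrum (𝓞 ℚ)} (hv : Rat.HeightOneSpectrum.natGenerator v = ℓ)
    {𝔓 : Ideal (absIntegers (𝓞 ℚ) ℚ)} (h𝔓 : 𝔓 ∈ v.primesAbove)
    {τ : absoluteGaloisGroup ℚ} (hτ : τ ∈ 𝔓.inertia (absoluteGaloisGroup ℚ)) (hrτ : r τ ≠ 1) :
    ℓ ∣ f := by
  by_contra hℓf
  haveI : 𝔓.IsPrime := h𝔓.1
  have hfv : ¬ ((Rat.HeightOneSpectrum.primesEquiv v : Nat.Primes) : ℕ) ∣ f := by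
    change ¬ Rat.HeightOneSpectrum.natGenerator v ∣ f; rwa [hv]
  have h1 : modNCyclotomicCharacter ℚ f τ = 1 :=
    modNCyclotomicCharacter_eq_one_of_mem_inertia (Rat.natCast_not_mem_of_mem_primesAbove_of_not_dvd h𝔓 hfv) hτ
  apply hrτ
  refine Units.ext ?_
  rw [Units.val_one, ← hφ τ, h1, Units.val_one, map_one]

/-- A Dirichlet character mod `f` vanishes at a prime `ℓ ∣ f` (`ℓ` is not a unit mod `f`; Kriz–Li's convention «`ψ(a) = 0` if
`(a, f(ψ)) ≠ 1`»). [cite: KrizLi2019, §2 (p. 11, conventions on primitive characters)] -/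
theorem apply_natCast_eq_zero_of_dvd_level {p : ℕ} [Fact p.Prime] {f : ℕ} (ψ : DirichletCharacter ℚ_[p] f)
    {ℓ : ℕ} (hℓ : ℓ.Prime) (hℓf : ℓ ∣ f) : ψ (ℓ : ZMod f) = 0 := by
  refine MulChar.map_nonunit _ (fun hu => ?_)
  rw [ZMod.isUnit_iff_coprime] at hu
  have h1 : ℓ ∣ Nat.gcd ℓ f := Nat.dvd_gcd (dvd_refl ℓ) hℓf
  rw [hu] at h1
  exact hℓ.one_lt.ne' (Nat.dvd_one.mp h1)

/-- **`ℓ ∣ f(ψ⁻¹ω)` for `ψ` primitive mod `f`, `ℓ ∣ f`, `ℓ ≠ p`.**  With `A = ψ⁻¹` and `B = ω` lifted to level `f·p` (so that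
`invMulOmega ψ ω = A·B`): `f = f(A) = f((A·B)·B⁻¹) ∣ lcm(f(A·B), f(B))` (Mathlib `conductor_mul_dvd_lcm_conductor`, `conductor_changeLevel`,
`conductor_inv`) and `f(B) ∣ p`; as `ℓ ∣ f` is a prime `≠ p`, `ℓ ∣ f(A·B)`.
[cite: Washington1997, Ch. 3 (conductors of products of Dirichlet characters)] [cite: KrizLi2019, Thm. 1.20 hypotheses (1), (3) (p. 7)] -/
theorem dvd_conductor_invMulOmega_of_dvd_level {p : ℕ} [hp : Fact p.Prime] {f : ℕ} [NeZero f]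
    {ψ : DirichletCharacter ℚ_[p] f} (hψ : ψ.IsPrimitive) (ω : DirichletCharacter ℚ_[p] p)
    {ℓ : ℕ} (hℓ : ℓ.Prime) (hℓf : ℓ ∣ f) (hℓp : ℓ ≠ p) :
    ℓ ∣ (invMulOmega ψ ω).conductor := by
  haveI : NeZero (f * p) := ⟨mul_ne_zero (NeZero.ne f) hp.out.ne_zero⟩
  set A : DirichletCharacter ℚ_[p] (f * p) := DirichletCharacter.changeLevel (dvd_mul_right f p) ψ⁻¹ with hAdef
  set B : DirichletCharacter ℚ_[p] (f * p) := DirichletCharacter.changeLevel (dvd_mul_left p f) ω with hBdef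
  have hAB : invMulOmega ψ ω = A * B := rfl
  have hA : A.conductor = f := by
    rw [hAdef, DirichletCharacter.conductor_changeLevel, DirichletCharacter.conductor_inv]; exact hψ
  have hB : B.conductor ∣ p := by
    rw [hBdef, DirichletCharacter.conductor_changeLevel]; exact DirichletCharacter.conductor_dvd_level ω
  have h1 : A = (A * B) * B⁻¹ := by rw [mul_assoc, mul_inv_cancel, mul_one]
  have h2 := DirichletCharacter.conductor_mul_dvd_lcm_conductor (A * B) B⁻¹
  rw [← h1, DirichletCharacter.conductor_inv, hA] at h2
  have h3 : ℓ ∣ (A * B).conductor * B.conductor := (hℓf.trans h2).trans (Nat.lcm_dvd_mul _ _)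
  rw [hAB]
  rcases (Nat.Prime.dvd_mul hℓ).mp h3 with h | h
  · exact h
  · exact absurd ((Nat.prime_dvd_prime_iff_eq hℓ hp.out).mp (h.trans hB)) hℓp

/-- **`(ψ⁻¹ω)(ℓ) = 0`** — the value at `ℓ` of the PRIMITIVE character inducing `ψ⁻¹ω` (tree `primVal`) vanishes when `ψ` is primitive mod
`f`, `ℓ ∣ f` and `ℓ ≠ p` (its conductor is divisible by `ℓ`, so `ℓ` is not a unit modulo it).
[cite: KrizLi2019, §2 (p. 11) and Thm. 1.20 (3) (p. 7)] -/
theorem primVal_invMulOmega_eq_zero_of_dvd_level {p : ℕ} [hp : Fact p.Prime] {f : ℕ} [NeZero f]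
    {ψ : DirichletCharacter ℚ_[p] f} (hψ : ψ.IsPrimitive) (ω : DirichletCharacter ℚ_[p] p)
    {ℓ : ℕ} (hℓ : ℓ.Prime) (hℓf : ℓ ∣ f) (hℓp : ℓ ≠ p) :
    primVal (invMulOmega ψ ω) ℓ = 0 := by
  have hdvd := dvd_conductor_invMulOmega_of_dvd_level hψ ω hℓ hℓf hℓp
  unfold primVal
  refine MulChar.map_nonunit _ (fun hu => ?_)
  rw [ZMod.isUnit_iff_coprime] at hu
  have h1 : ℓ ∣ Nat.gcd ℓ (invMulOmega ψ ω).conductor := Nat.dvd_gcd (dvd_refl ℓ) hdvd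
  rw [hu] at h1
  exact hℓ.one_lt.ne' (Nat.dvd_one.mp h1)

/-! ### §4 Kriz–Li's character data WITH hypothesis (3), for every curve with `E[p]` reducible, `p ≥ 5` -/

/-- **Kriz–Li's character data WITH hypothesis (3), for every `E/ℚ` with `E[p]` reducible and `p ≥ 5`.**  For `W/ℚ` globally minimal
elliptic, a prime `p ≥ 5` and `¬ W.HasIrreducibleModPGaloisRep p`: there are a level `f ≥ 1` supported on `p·N_W`, a PRIMITIVE
`ψ : (ℤ/f)ˣ → ℚ_pˣ` and a Teichmüller `ω` mod `p` with the trace form `‖a_ℓ(W) − (ψ(ℓ) + ψ⁻¹(ℓ)ω(ℓ))‖_p < 1` at every prime `ℓ ∤ p·N_W`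
(generation 36's `exists_krizLiCharacterData_of_red`, proof repeated: `ψ = ω ∘ φ` for the isogeny character `r = φ ∘ χ_f` of a rational
`p`-line), such that moreover EVERY ADDITIVE PRIME `ℓ ≠ p` OF `W` DIVIDES `f` (§2: `r` is ramified at `ℓ`; §3: so `ℓ ∣ f`), whence Kriz–Li's
hypothesis (3) `ψ(ℓ) ≠ 1 ∧ (ψ⁻¹ω)(ℓ) ≠ 1` (both values are `0`) in the shape of `KrizLi2019.thm120_padicLogHeegner_unit_of_bernoulli`.
UNCONDITIONAL. [cite: KrizLi2019, Thm. 1.20 (pp. 7–8) and §2 (pp. 11–12)] [cite: Mazur1978, §5 (p. 148) and Prop. 6.3 (1) (p. 153)]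
[cite: SilvermanAEC2009, Thm. VII.6.1 and proof of Thm. VII.7.1 (PDF pp. 177–179)] [cite: Washington1997, Thm. 14.1, Ch. 3, §5.1] -/
theorem exists_krizLiCharacterData_h3_of_red (W : WeierstrassCurve ℚ) [W.IsElliptic] [W.IsGloballyMinimal]
    (p : ℕ) [hp : Fact p.Prime] (h5 : 5 ≤ p) (hred : ¬ W.HasIrreducibleModPGaloisRep p) :
    ∃ (f : ℕ) (_ : NeZero f) (ψ : DirichletCharacter ℚ_[p] f) (ω : DirichletCharacter ℚ_[p] p),
      ψ.IsPrimitive ∧ IsTeichmullerCharacter ω ∧ (∀ q : ℕ, q.Prime → q ∣ f → q ∣ p * W.conductorNorm ℤ) ∧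
      (∀ ℓ : ℕ, ℓ.Prime → ¬ (ℓ ∣ p * W.conductorNorm ℤ) →
        ‖((W.LFunction ℓ : ℤ) : ℚ_[p]) - (ψ (ℓ : ZMod f) + ψ⁻¹ (ℓ : ZMod f) * ω (ℓ : ZMod p))‖ < 1) ∧
      -- NEW: every additive prime `ℓ ≠ p` divides the conductor `f` of `ψ` …
      (∀ ℓ : ℕ, (hℓ : ℓ.Prime) → ℓ ≠ p →
        (haveI := Fact.mk hℓ; ¬ W.HasGoodReductionAtPrime ℓ ∧ ¬ W.HasMultiplicativeReductionAtPrime ℓ) → ℓ ∣ f) ∧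
      -- … hence Kriz–Li's hypothesis (3), in the shape of `thm120_padicLogHeegner_unit_of_bernoulli`
      (∀ ℓ : ℕ, (hℓ : ℓ.Prime) → ℓ ≠ p →
        (haveI := Fact.mk hℓ; ¬ W.HasGoodReductionAtPrime ℓ ∧ ¬ W.HasMultiplicativeReductionAtPrime ℓ) →
        ψ (ℓ : ZMod f) ≠ 1 ∧ primVal (invMulOmega ψ ω) ℓ ≠ 1) := by
  have hpP : p.Prime := hp.out
  -- a stable line `⟨T⟩` and its isogeny character `r` (as in `IsogenyCharacterDirichlet` §5)
  obtain ⟨H, hH, hcard⟩ := (Mazur1978.not_hasIrreducibleModPGaloisRep_iff_exists_natCard_eq W p).mp hred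
  obtain ⟨T, hT0, rfl⟩ := Mazur1978.exists_eq_zmultiples_of_natCard_eq W p hcard
  have hst : ∀ σ : absoluteGaloisGroup ℚ, σ • T ∈ AddSubgroup.zmultiples T :=
    fun σ => hH σ T (AddSubgroup.mem_zmultiples T)
  obtain ⟨r, hr⟩ := Mazur1978.exists_isogenyCharacter W p hT0 hst
  have hker := Mazur1978.isOpen_ker_of_smul_eq W p hT0 hr
  -- good reduction off `p·N_W`
  have hgood : ∀ (q : ℕ) [Fact q.Prime], ¬ q ∣ p * W.conductorNorm ℤ → W.HasGoodReductionAtPrime q := by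
    intro q _ hqnd
    by_contra hng
    exact hqnd (dvd_mul_of_dvd_right ((W.dvd_conductorNorm_iff_not_hasGoodReductionAtPrime q).mpr hng) p)
  -- `r` is unramified outside `S` = the bad primes and `p`
  set S : Set ℕ := {q | q.Prime ∧ q ∣ p * W.conductorNorm ℤ} with hSdef
  have hunr : ∀ q : ℕ, q.Prime → q ∉ S → ∀ (v : HeightOneSpectrum (𝓞 ℚ)), Rat.HeightOneSpectrum.natGenerator v = q →
      ∀ 𝔓 ∈ v.primesAbove, ∀ τ ∈ 𝔓.inertia (absoluteGaloisGroup ℚ), r τ = 1 := by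
    intro q hq hqS v hgen 𝔓 h𝔓 τ hτ
    have hqnd : ¬ q ∣ p * W.conductorNorm ℤ := fun h => hqS ⟨hq, h⟩
    have hgoodv : W.HasGoodReductionAt v := by
      haveI hF := Fact.mk (Rat.HeightOneSpectrum.primesEquiv v).2
      refine (hasGoodReductionAtPrime_iff_hasGoodReductionAt_ringOfIntegers v W).mp (hgood _ ?_)
      have hq' : ((Rat.HeightOneSpectrum.primesEquiv v : Nat.Primes) : ℕ) = q := hgen
      rw [hq']
      exact hqnd
    have hpv : ((p : ℕ) : 𝓞 ℚ) ∉ v.asIdeal := by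
      intro hmem
      have h1 : ((Rat.HeightOneSpectrum.primesEquiv v : Nat.Primes) : ℕ) = p := primesEquiv_eq_of_natCast_mem hpP hmem
      have h2 : ((Rat.HeightOneSpectrum.primesEquiv v : Nat.Primes) : ℕ) = q := hgen
      exact hqnd (by rw [← h2, h1]; exact dvd_mul_right p _)
    exact Mazur1978.isogenyCharacter_eq_one_of_mem_inertia W p hT0 hr hgoodv hpv h𝔓 hτ
  -- `r = φ ∘ χ_f`, `φ` primitive, `f` supported on `S`
  obtain ⟨f, hf, φ, hφprim, hfS, hφ⟩ := IsogenyCharacterDirichlet.exists_isPrimitive_zmod_of_character p r hker S hunr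
  -- NEW (§2–§3): every additive prime `ℓ ≠ p` divides `f` — `r` is ramified there (`p ≥ 5`)
  have hdvd : ∀ ℓ : ℕ, (hℓ : ℓ.Prime) → ℓ ≠ p →
      (haveI := Fact.mk hℓ; ¬ W.HasGoodReductionAtPrime ℓ ∧ ¬ W.HasMultiplicativeReductionAtPrime ℓ) → ℓ ∣ f := by
    intro ℓ hℓ hℓp hadd
    obtain ⟨v, hv, 𝔓, h𝔓, τ, hτ, hrτ⟩ :=
      exists_mem_inertia_isogenyCharacter_ne_one W p h5 hT0 hr hℓ hℓp hadd.1 hadd.2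
    exact dvd_level_of_inertia_ne_one hφ hv h𝔓 hτ hrτ
  -- the Teichmüller lift `ψ = ω ∘ φ`
  obtain ⟨ω, hω⟩ := KrizLi2019.exists_isTeichmullerCharacter (p := p)
  have hψprim := IsogenyCharacterDirichlet.isPrimitive_teichmullerLift hω hφprim
  refine ⟨f, hf, MulChar.ofUnitHom (ω.toUnitHom.comp φ.toUnitHom), ω, hψprim, hω,
    fun q hq hqf => (hfS q hq hqf).2, ?_, hdvd, fun ℓ hℓ hℓp hadd => ?_⟩
  · -- the trace form at a prime `ℓ ∤ p·N_W` (verbatim `IsogenyCharacterDirichlet` §5)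
    intro ℓ hℓ hℓpN
    haveI := Fact.mk hℓ
    have hℓp : ℓ ≠ p := fun h => hℓpN (by rw [h]; exact dvd_mul_right p _)
    have hpℓ : ¬ p ∣ ℓ := fun h => hℓp ((Nat.prime_dvd_prime_iff_eq hpP hℓ).mp h).symm
    have hgoodℓ : W.HasGoodReductionAtPrime ℓ := hgood ℓ hℓpN
    have hℓf : ¬ ℓ ∣ f := fun h => hℓpN (hfS ℓ hℓ h).2
    set v : HeightOneSpectrum (𝓞 ℚ) := Rat.HeightOneSpectrum.primesEquiv.symm ⟨ℓ, hℓ⟩ with hvdef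
    have hgen : Rat.HeightOneSpectrum.natGenerator v = ℓ := by
      change ((Rat.HeightOneSpectrum.primesEquiv v : Nat.Primes) : ℕ) = ℓ
      rw [hvdef, Equiv.apply_symm_apply]
    have hvℓ : ((ℓ : ℕ) : 𝓞 ℚ) ∈ v.asIdeal := by
      have h := Mazur1978.natCast_natGenerator_mem_asIdeal v
      rwa [hgen] at h
    obtain ⟨𝔓, h𝔓⟩ := HeightOneSpectrum.primesAbove_nonempty v
    obtain ⟨φF, hφF⟩ := exists_isArithFrobAt_of_mem_primesAbove_holds (K := ℚ) (v := v) h𝔓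
    have htrace := Mazur1978.isogenyCharacter_add_div_eq_frobeniusTrace W p ℓ hℓp hgoodℓ hT0 hr hvℓ h𝔓 hφF
    have hχ : ((modNCyclotomicCharacter ℚ f φF : (ZMod f)ˣ) : ZMod f) = (ℓ : ℕ) :=
      Literature.NumberTheory.GaloisRepresentations.Rat.modNCyclotomicCharacter_of_isArithFrobAt hℓ hℓf hvℓ h𝔓 hφF
    have hcop : Nat.Coprime ℓ f := (Nat.Prime.coprime_iff_not_dvd hℓ).mpr hℓf
    set xu : (ZMod f)ˣ := ZMod.unitOfCoprime ℓ hcop with hxudef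
    have hxu : (xu : ZMod f) = (ℓ : ZMod f) := ZMod.coe_unitOfCoprime ℓ hcop
    set u : (ZMod p)ˣ := r φF with hudef
    have hφℓ : φ (ℓ : ZMod f) = (u : ZMod p) := by rw [← hχ, hφ φF]
    have hψℓ : (MulChar.ofUnitHom (ω.toUnitHom.comp φ.toUnitHom) : DirichletCharacter ℚ_[p] f) (ℓ : ZMod f) =
        ω (u : ZMod p) := by
      rw [← hxu, IsogenyCharacterDirichlet.teichmullerLift_coe_unit, hxu, hφℓ]
    have hψℓ' : (MulChar.ofUnitHom (ω.toUnitHom.comp φ.toUnitHom) : DirichletCharacter ℚ_[p] f)⁻¹ (ℓ : ZMod f) =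
        (ω (u : ZMod p))⁻¹ := by
      rw [MulChar.inv_apply_eq_inv', hψℓ]
    rw [hψℓ, hψℓ', LFunction_apply_prime_eq_frobeniusTrace W ℓ hgoodℓ]
    exact IsogenyCharacterDirichlet.norm_sub_lt_one_of_trace_congr hω u hpℓ (W.frobeniusTrace ℓ) htrace
  · -- NEW: hypothesis (3)
    have hℓf := hdvd ℓ hℓ hℓp hadd
    refine ⟨?_, ?_⟩
    · rw [apply_natCast_eq_zero_of_dvd_level _ hℓ hℓf]; exact zero_ne_one
    · rw [primVal_invMulOmega_eq_zero_of_dvd_level hψprim ω hℓ hℓf hℓp]; exact zero_ne_one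

/-! ### §5 On the K1 door at `p ≥ 5`: the Kriz–Li road needs (1), (2) and the Bernoulli pair only -/

/-- **On the K1 door at `p ≥ 5` the Kriz–Li character data exist WITH hypothesis (3)** (`ClassX3 W p` contains `E[p]` reducible): the
binders `(f, ψ, ω)` of `KrizLi2019.thm120_padicLogHeegner_unit_of_bernoulli` and of generation 36's records, with primitivity, the
Teichmüller property, `f` supported on `p·N_W`, the trace form, «additive `ℓ ≠ p` ⇒ `ℓ ∣ f`», and (3).  UNCONDITIONAL.
[cite: KrizLi2019, Thm. 1.20 (pp. 7–8)] [cite: Mazur1978, §5 (p. 148)] -/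
theorem exists_krizLiCharacterData_h3_of_classX3 (W : WeierstrassCurve ℚ) [W.IsElliptic] [W.IsGloballyMinimal]
    (p : ℕ) [Fact p.Prime] (h5 : 5 ≤ p) (hX : Rank1Residual.ClassX3 W p) :
    ∃ (f : ℕ) (_ : NeZero f) (ψ : DirichletCharacter ℚ_[p] f) (ω : DirichletCharacter ℚ_[p] p),
      ψ.IsPrimitive ∧ IsTeichmullerCharacter ω ∧ (∀ q : ℕ, q.Prime → q ∣ f → q ∣ p * W.conductorNorm ℤ) ∧
      (∀ ℓ : ℕ, ℓ.Prime → ¬ (ℓ ∣ p * W.conductorNorm ℤ) →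
        ‖((W.LFunction ℓ : ℤ) : ℚ_[p]) - (ψ (ℓ : ZMod f) + ψ⁻¹ (ℓ : ZMod f) * ω (ℓ : ZMod p))‖ < 1) ∧
      (∀ ℓ : ℕ, (hℓ : ℓ.Prime) → ℓ ≠ p →
        (haveI := Fact.mk hℓ; ¬ W.HasGoodReductionAtPrime ℓ ∧ ¬ W.HasMultiplicativeReductionAtPrime ℓ) → ℓ ∣ f) ∧
      (∀ ℓ : ℕ, (hℓ : ℓ.Prime) → ℓ ≠ p →
        (haveI := Fact.mk hℓ; ¬ W.HasGoodReductionAtPrime ℓ ∧ ¬ W.HasMultiplicativeReductionAtPrime ℓ) →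
        ψ (ℓ : ZMod f) ≠ 1 ∧ primVal (invMulOmega ψ ω) ℓ ≠ 1) :=
  exists_krizLiCharacterData_h3_of_red W p h5 hX.1

open Summit.BirchSwinnertonDyer.Rank1Residual Literature.NumberTheory.EllipticCurves.Rank1Residual
  Literature.NumberTheory.EllipticCurves.Rank1Residual.Typed
  Summit.BirchSwinnertonDyer.BirchSwinnertonDyer.Theses.SchneiderFreeAdditiveX3 in
/-- **The Kriz–Li road of the K1 door at `p ≥ 5` WITHOUT hypothesis (3).**  For `W/ℚ` globally minimal on the door (`r_an(W) = 1`,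
`ClassX3 W p`, semistable twist) at a prime `p ≥ 5` with (2) no prime of split multiplicative reduction: if for EVERY admissible character
datum `(f, ψ, ω)` of `W` at `p` (primitive `ψ`, Teichmüller `ω`, `f` supported on `p·N_W`, trace form, every additive `ℓ ≠ p` dividing `f` —
such data exist, `exists_krizLiCharacterData_h3_of_classX3`) one has (1) `ψ(p) ≠ 1`, `(ψ⁻¹ω)(p) ≠ 1` and an imaginary quadratic Heegner
field `K` of `N_W` with odd `d_K`, its Kronecker character `ε_K`, and the Bernoulli pair (4) `B_{1,ψ₀⁻¹ε_K}·B_{1,ψ₀ω⁻¹} ≢ 0 (mod p)`, then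
`MissingLowerBoundAt W p` (the lower half of BSD_p at `W`) — by §4 and generation 36's
`KrizLiLocusLValueFree.missingLowerBoundAt_of_printedFacts_of_thm120_of_heegnerField`, hypothesis (3) being supplied by §4.  CONDITIONAL on
`hF` (`PrintedFacts`) and `hKL` (Kriz–Li Thm. 1.20, published); closes nothing by name; BSD is NOT advanced.
[cite: KrizLi2019, Thm. 1.20 (pp. 7–8)] [cite: GrossZagier1986, Thm. I.(6.3)] [cite: JetchevSkinnerWan2017, §7.4.1 (arXiv:1512.06894 p. 30)] -/
theorem missingLowerBoundAt_of_printedFacts_of_thm120_of_forall_data_of_five_le (hF : PrintedFacts)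
    (hKL : KrizLi2019.thm120_padicLogHeegner_unit_of_bernoulli)
    (W : WeierstrassCurve ℚ) [W.IsElliptic] [W.IsGloballyMinimal] (p : ℕ) [Fact p.Prime]
    (hr : W.analyticRank = 1) (h5 : 5 ≤ p) (hX : ClassX3 W p) (hS : Additive.SubSemistableTwist W p)
    -- (2) no prime of split multiplicative reduction
    (h2 : ∀ ℓ : ℕ, (hℓ : ℓ.Prime) → ¬ (haveI := Fact.mk hℓ; W.HasSplitMultiplicativeReductionAtPrime ℓ))
    -- for every admissible character datum: (1) and a Heegner field with the Bernoulli pair (4)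
    (hdat : ∀ (f : ℕ) [NeZero f] (ψ : DirichletCharacter ℚ_[p] f) (ω : DirichletCharacter ℚ_[p] p),
      ψ.IsPrimitive → IsTeichmullerCharacter ω → (∀ q : ℕ, q.Prime → q ∣ f → q ∣ p * W.conductorNorm ℤ) →
      (∀ ℓ : ℕ, ℓ.Prime → ¬ (ℓ ∣ p * W.conductorNorm ℤ) →
        ‖((W.LFunction ℓ : ℤ) : ℚ_[p]) - (ψ (ℓ : ZMod f) + ψ⁻¹ (ℓ : ZMod f) * ω (ℓ : ZMod p))‖ < 1) →
      (∀ ℓ : ℕ, (hℓ : ℓ.Prime) → ℓ ≠ p →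
        (haveI := Fact.mk hℓ; ¬ W.HasGoodReductionAtPrime ℓ ∧ ¬ W.HasMultiplicativeReductionAtPrime ℓ) → ℓ ∣ f) →
      ψ (p : ZMod f) ≠ 1 ∧ primVal (invMulOmega ψ ω) p ≠ 1 ∧
      ∃ (K : Type) (_ : Field K) (_ : NumberField K) (εK : DirichletCharacter ℚ_[p] (NumberField.discr K).natAbs),
        IsImaginaryQuadratic K ∧ Odd (NumberField.discr K) ∧ SatisfiesHeegnerHypothesis (W.conductorNorm ℤ) K ∧
        IsKroneckerCharacterOf K εK ∧
        ¬ (‖bernoulliOnePrim (bernoulliCharOne ψ εK) * bernoulliOnePrim (bernoulliCharTwo ψ εK ω)‖ ≤ (p : ℝ)⁻¹)) :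
    MissingLowerBoundAt W p := by
  have hp2 : p ≠ 2 := by omega
  obtain ⟨f, hf, ψ, ω, hψ, hω, hfN, hss, hdvd, h3⟩ := exists_krizLiCharacterData_h3_of_classX3 W p h5 hX
  obtain ⟨h1, h1', K, _, _, εK, hK, hodd, hHe, hεK, h4⟩ := hdat f ψ ω hψ hω hfN hss hdvd
  exact KrizLiLocusLValueFree.missingLowerBoundAt_of_printedFacts_of_thm120_of_heegnerField hF hKL W p hr hp2 hX hS
    f ψ ω hψ hω hss h1 h1' h2 h3 K hK hodd hHe εK hεK h4

end Summit.BirchSwinnertonDyer.BirchSwinnertonDyer.Theorems.SchneiderFreeAdditiveX3.KrizLiThreeAutomatic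

end
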